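import Summits.BirchSwinnertonDyer.BirchSwinnertonDyer.Theorems.GenusKolyvaginAtTwoTorsionCellD0ParityLocalIndex
import Mathlib.Combinatorics.Pigeonhole
import HarnessLib

/-!
# D0≤2, parity of the genus twist, IV: the relaxed Selmer group has at least `2^m` elements (pigeonhole on cosets)

Crux R″ `RankOneTwoTorsionResidualAtTwo` (stmt-27478), LINE 49 «full_vertex», stub D0≤2
`FullTorsionGenusSelmerLawUpToTwoAtTwo`, slice `#Q₀ = 2`, the `2`-PARITY HALF of `#Sel⁽²⁾(E₀^{(−p₀q₁q₂)}) = 8`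
made UNCONDITIONAL.  **`exists_finset_relaxed`**: for `E/ℚ` with rational `2`-torsion and finite sets of primes
`S ⊆ Tot` with `2·#S + m ≤ 2·#Tot + 1`, there are at least `2^m` classes of `H¹(ℚ, E[2])` with components supported on
`Tot` (parities `0` off `Tot`) satisfying `E`'s local Selmer condition at every prime of `S`: the `4^{#Tot+1}` explicit
classes `c(±∏T, ±∏T')` (`T, T' ⊆ Tot`) are pairwise distinct and fall into at most `2·4^{#S}` cosets of
`⋂_{ℓ ∈ S} H¹_𝓚(ℚ_ℓ)` (`…ParityLocalIndex.index_selmerLocalKer_le`), and differences within one coset are relaxed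
classes.  For `#Tot = #S + 3`, `m = 7`: the relaxed Selmer group of KMR's argument has `≥ 2⁷` elements — in print
this is Poitou–Tate (KMR Thm. 3.9); here it is a count.

Everything is proved; no LINE 49 statement is restated; BSD is not advanced by this file alone.

## References

* [KlagsbrunMazurRubin2013] Z. Klagsbrun, B. Mazur, K. Rubin, Ann. of Math. 178 (2013), Thm. 3.9.
* [SilvermanAEC2009] J. H. Silverman, *The Arithmetic of Elliptic Curves*, 2nd ed., Prop. X.1.4 (`Sel ⊆ K(S,2)²`).
-/

noncomputable section

open scoped Classical

namespace Summit.BirchSwinnertonDyer.BirchSwinnertonDyer.Theorems.GenusKolyvaginAtTwo.TorsionCellD0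

open WeierstrassCurve WeierstrassCurve.Affine WeierstrassCurve.Affine.Point
open Literature.NumberTheory.GaloisRepresentations Literature.NumberTheory.EllipticCurves Field
open Literature.NumberTheory.EllipticCurves.TwoDescentLocal
open Literature.NumberTheory.EllipticCurves.KramerTwoDescent
open Literature.NumberTheory.QuadraticForms
open IsDedekindDomain NumberField Rat.HeightOneSpectrum

/-! ## §3 The count of relaxed classes -/

section Count

variable (E : WeierstrassCurve ℚ) [E.IsElliptic] {e₁ e₂ e₃ : ℚ}

/-- The signed square-free product attached to `(T, ε)`: `(−1)^ε ∏_{ℓ ∈ T} ℓ`, non-zero. [folklore] -/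
private theorem signedProd_ne_zero (T : Finset ℕ) (hT : ∀ ℓ ∈ T, ℓ.Prime) (ε : ZMod 2) :
    (if ε = 1 then (-1 : ℚ) else 1) * ∏ ℓ ∈ T, (ℓ : ℚ) ≠ 0 :=
  mul_ne_zero (by split_ifs <;> norm_num)
    (Finset.prod_ne_zero_iff.mpr fun ℓ hℓ => by exact_mod_cast (hT ℓ hℓ).ne_zero)

/-- The bits of a signed square-free product: `parityBit q = [q ∈ T]` for a prime `q`, `signBit = ε`. [folklore] -/
private theorem bits_signedProd (T : Finset ℕ) (hT : ∀ ℓ ∈ T, ℓ.Prime) (ε : ZMod 2) (q : ℕ) [Fact q.Prime] :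
    parityBit q ((if ε = 1 then (-1 : ℚ) else 1) * ∏ ℓ ∈ T, (ℓ : ℚ)) = (if q ∈ T then 1 else 0) ∧
      signBit ((if ε = 1 then (-1 : ℚ) else 1) * ∏ ℓ ∈ T, (ℓ : ℚ)) = ε := by
  have hε0 : (if ε = 1 then (-1 : ℚ) else 1) ≠ 0 := by split_ifs <;> norm_num
  have hprod0 : ∏ ℓ ∈ T, (ℓ : ℚ) ≠ 0 := Finset.prod_ne_zero_iff.mpr fun ℓ hℓ => by exact_mod_cast (hT ℓ hℓ).ne_zero
  have hprodpos : 0 < ∏ ℓ ∈ T, (ℓ : ℚ) := Finset.prod_pos fun ℓ hℓ => by exact_mod_cast (hT ℓ hℓ).pos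
  refine ⟨?_, ?_⟩
  · rw [parityBit_mul hε0 hprod0, parityBit_prod_primes hT q]
    have : parityBit q (if ε = 1 then (-1 : ℚ) else 1) = 0 := by
      split_ifs
      · rw [parityBit, padicValRat.neg, padicValRat.one, Int.cast_zero]
      · rw [parityBit, padicValRat.one, Int.cast_zero]
    rw [this, zero_add]
  · rw [signBit_mul hε0 hprod0, (signBit_eq_zero_iff hprod0).mpr hprodpos, add_zero, signBit]
    have hε : ε = 0 ∨ ε = 1 := by revert ε; decide
    rcases hε with rfl | rfl <;> simp

/-- **At least `2^m` relaxed classes.**  Let `E/ℚ` have rational `2`-torsion `e₁, e₂, e₃`, let `S ⊆ Tot` be finite sets of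
primes with `2·#S + m ≤ 2·#Tot + 1` and `2 ∈ S`.  Then there is a set of at least `2^m` classes of `H¹(ℚ, E[2])` whose two
components have EVEN valuation at every prime outside `Tot` and which satisfy `E`'s local Selmer condition at every
prime of `S`.  Proof: the `4^{#Tot+1}` classes `c(±∏T, ±∏T')`, `T, T' ⊆ Tot`, are pairwise distinct (their bits differ) and
fall into at most `∏_{ℓ ∈ S} [H¹(ℚ,E[2]) : H¹_𝓚(ℚ_ℓ)] ≤ 2 · 4^{#S}` cosets of `⋂_{ℓ∈S} H¹_𝓚(ℚ_ℓ)`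
(`index_selmerLocalKer_le`); one coset contains `≥ 2^m` of them, and subtracting a fixed one gives relaxed classes.
(In print: `dim` of the relaxed Selmer group by Poitou–Tate; KMR Thm. 3.9.) [cite: KlagsbrunMazurRubin2013, Thm. 3.9]
[cite: SilvermanAEC2009, Prop. X.1.4] -/
theorem exists_finset_relaxed (h : E.toAffine.SplitTwoTorsion e₁ e₂ e₃) (S Tot : Finset ℕ) (hTot : ∀ q ∈ Tot, q.Prime)
    (hST : S ⊆ Tot) {m : ℕ} (hm : 2 * S.card + m ≤ 2 * Tot.card + 1) :
    ∃ X : Finset (galH1Torsion E 2), 2 ^ m ≤ X.card ∧ ∀ c ∈ X,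
      (∀ (ℓ : ℕ) [Fact ℓ.Prime], ℓ ∉ Tot →
        parityHom ℓ (kummerEquiv ℚ 2 (E.twoTorsionCharH1 h c)) = 0 ∧
          parityHom ℓ (kummerEquiv ℚ 2 (E.twoTorsionCharH1 h.swap₁₂ c)) = 0) ∧
      (∀ v : HeightOneSpectrum (𝓞 ℚ), natGenerator v ∈ S → c ∈ selmerLocalKer E (v.adicCompletion ℚ) 2) := by
  -- the explicit family
  let g : Finset ℕ × ZMod 2 → ℚ := fun d => (if d.2 = 1 then (-1 : ℚ) else 1) * ∏ ℓ ∈ d.1, (ℓ : ℚ)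
  have hg0 : ∀ d : Tot.powerset × ZMod 2, g (d.1.1, d.2) ≠ 0 := fun d =>
    signedProd_ne_zero d.1.1 (fun ℓ hℓ => hTot ℓ (Finset.mem_powerset.mp d.1.2 hℓ)) d.2
  let Φ : (Tot.powerset × ZMod 2) × (Tot.powerset × ZMod 2) → galH1Torsion E 2 := fun dd =>
    E.twoDescentClass h (Units.mk0 _ (hg0 dd.1)) (Units.mk0 _ (hg0 dd.2))
  -- its bits
  have hbits : ∀ (dd : (Tot.powerset × ZMod 2) × (Tot.powerset × ZMod 2)) (q : ℕ) [Fact q.Prime],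
      parityHom q (kummerEquiv ℚ 2 (E.twoTorsionCharH1 h (Φ dd))) = (if q ∈ dd.1.1.1 then 1 else 0) ∧
      parityHom q (kummerEquiv ℚ 2 (E.twoTorsionCharH1 h.swap₁₂ (Φ dd))) = (if q ∈ dd.2.1.1 then 1 else 0) ∧
      signHom (kummerEquiv ℚ 2 (E.twoTorsionCharH1 h (Φ dd))) = dd.1.2 ∧
      signHom (kummerEquiv ℚ 2 (E.twoTorsionCharH1 h.swap₁₂ (Φ dd))) = dd.2.2 := by
    intro dd q _
    have h1 := bits_signedProd dd.1.1.1 (fun ℓ hℓ => hTot ℓ (Finset.mem_powerset.mp dd.1.1.2 hℓ)) dd.1.2 q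
    have h2 := bits_signedProd dd.2.1.1 (fun ℓ hℓ => hTot ℓ (Finset.mem_powerset.mp dd.2.1.2 hℓ)) dd.2.2 q
    simp only [Φ, E.kummerEquiv_twoTorsionCharH1_twoDescentClass h, E.kummerEquiv_twoTorsionCharH1_swap_twoDescentClass h,
      mk_eq_sqClass_coe, Units.val_mk0, parityHom_sqClass (hg0 _), signHom_sqClass (hg0 _)]
    exact ⟨h1.1, h2.1, h1.2, h2.2⟩
  -- injectivity
  have hinj : Function.Injective Φ := by
    intro dd dd' hdd
    have key : ∀ q : ℕ, q.Prime → ((q ∈ dd.1.1.1 ↔ q ∈ dd'.1.1.1) ∧ (q ∈ dd.2.1.1 ↔ q ∈ dd'.2.1.1)) := by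
      intro q hq
      haveI : Fact q.Prime := ⟨hq⟩
      obtain ⟨a1, a2, -, -⟩ := hbits dd q
      obtain ⟨b1, b2, -, -⟩ := hbits dd' q
      rw [hdd] at a1 a2
      rw [a1] at b1
      rw [a2] at b2
      constructor
      · constructor
        · intro hq'; by_contra hq''; rw [if_pos hq', if_neg hq''] at b1; exact one_ne_zero b1
        · intro hq'; by_contra hq''; rw [if_neg hq'', if_pos hq'] at b1; exact zero_ne_one b1
      · constructor
        · intro hq'; by_contra hq''; rw [if_pos hq', if_neg hq''] at b2; exact one_ne_zero b2
        · intro hq'; by_contra hq''; rw [if_neg hq'', if_pos hq'] at b2; exact zero_ne_one b2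
    haveI : Fact (Nat.Prime 2) := ⟨Nat.prime_two⟩
    obtain ⟨-, -, s1, s2⟩ := hbits dd 2
    obtain ⟨-, -, s1', s2'⟩ := hbits dd' 2
    rw [hdd] at s1 s2
    have hT1 : dd.1.1.1 = dd'.1.1.1 := by
      ext q
      by_cases hq : q.Prime
      · exact (key q hq).1
      · constructor
        · intro hq'; exact absurd (hTot q (Finset.mem_powerset.mp dd.1.1.2 hq')) hq
        · intro hq'; exact absurd (hTot q (Finset.mem_powerset.mp dd'.1.1.2 hq')) hq
    have hT2 : dd.2.1.1 = dd'.2.1.1 := by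
      ext q
      by_cases hq : q.Prime
      · exact (key q hq).2
      · constructor
        · intro hq'; exact absurd (hTot q (Finset.mem_powerset.mp dd.2.1.2 hq')) hq
        · intro hq'; exact absurd (hTot q (Finset.mem_powerset.mp dd'.2.1.2 hq')) hq
    obtain ⟨⟨T1, ε1⟩, ⟨T2, ε2⟩⟩ := dd
    obtain ⟨⟨T1', ε1'⟩, ⟨T2', ε2'⟩⟩ := dd'
    simp only at hT1 hT2 s1 s2 s1' s2'
    rw [Subtype.ext hT1, Subtype.ext hT2, s1.symm.trans s1', s2.symm.trans s2']
  -- the subgroup `H = ⋂_{ℓ ∈ S} H¹_𝓚(ℚ_ℓ)` and its index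
  let K : ℕ → AddSubgroup (galH1Torsion E 2) := fun ℓ =>
    if hℓ : ℓ.Prime then selmerLocalKer E (((primesEquiv (R := 𝓞 ℚ)).symm ⟨ℓ, hℓ⟩).adicCompletion ℚ) 2 else ⊤
  have hK : ∀ T : Finset ℕ, T ⊆ Tot →
      (T.inf K).index ≠ 0 ∧ (T.inf K).index ≤ 4 ^ T.card * (if 2 ∈ T then 2 else 1) := by
    intro T hT
    induction T using Finset.induction_on with
    | empty => simp [AddSubgroup.index_top]
    | insert a T ha ih =>
      obtain ⟨ih0, ihle⟩ := ih (fun x hx => hT (Finset.mem_insert_of_mem hx))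
      have hap : a.Prime := hTot a (hT (Finset.mem_insert_self a T))
      have hgen : natGenerator ((primesEquiv (R := 𝓞 ℚ)).symm ⟨a, hap⟩) = a :=
        congrArg Subtype.val ((primesEquiv (R := 𝓞 ℚ)).apply_symm_apply ⟨a, hap⟩)
      have hKa : (K a).index ≠ 0 ∧ (K a).index ≤ (if a = 2 then 8 else 4) := by
        simp only [K, dif_pos hap]
        have := index_selmerLocalKer_le E h ((primesEquiv (R := 𝓞 ℚ)).symm ⟨a, hap⟩)
        rwa [hgen] at this
      rw [Finset.inf_insert, Finset.card_insert_of_notMem ha]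
      refine ⟨AddSubgroup.index_inf_ne_zero hKa.1 ih0, (AddSubgroup.index_inf_le).trans ?_⟩
      refine (Nat.mul_le_mul hKa.2 ihle).trans ?_
      by_cases ha2 : a = 2
      · subst ha2
        rw [if_pos rfl, if_neg ha, if_pos (Finset.mem_insert_self 2 T), pow_succ]
        omega
      · rw [if_neg ha2]
        have : (2 ∈ insert a T) ↔ 2 ∈ T := by
          rw [Finset.mem_insert]; exact ⟨fun h => h.resolve_left (Ne.symm ha2), Or.inr⟩
        simp only [this, pow_succ]
        split_ifs <;> omega
  obtain ⟨hH0, hHle⟩ := hK S hST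
  set H := S.inf K with hHdef
  haveI : H.FiniteIndex := ⟨hH0⟩
  haveI : Finite (galH1Torsion E 2 ⧸ H) := AddSubgroup.finite_quotient_of_finiteIndex
  letI : Fintype (galH1Torsion E 2 ⧸ H) := Fintype.ofFinite _
  -- pigeonhole on the cosets
  let X₀ : Finset (galH1Torsion E 2) := Finset.univ.image Φ
  have hX₀card : X₀.card = 2 ^ (2 * Tot.card + 2) := by
    rw [Finset.card_image_of_injective _ hinj, Finset.card_univ, Fintype.card_prod, Fintype.card_prod,
      Fintype.card_coe, Finset.card_powerset, ZMod.card]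
    ring
  have hcardq : Fintype.card (galH1Torsion E 2 ⧸ H) = H.index := by
    rw [AddSubgroup.index_eq_card, Nat.card_eq_fintype_card]
  have hHle' : H.index ≤ 2 ^ (2 * S.card + 1) := by
    refine hHle.trans ?_
    rw [pow_succ, pow_mul, show (2 : ℕ) ^ 2 = 4 by norm_num]
    split_ifs <;> omega
  obtain ⟨y, -, hy⟩ := Finset.exists_le_card_fiber_of_mul_le_card_of_maps_to
    (f := fun c : galH1Torsion E 2 => QuotientAddGroup.mk' H c)
    (s := X₀) (t := Finset.univ) (n := 2 ^ m) (fun _ _ => Finset.mem_univ _) Finset.univ_nonempty (by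
      rw [Finset.card_univ, hcardq, hX₀card]
      calc H.index * 2 ^ m ≤ 2 ^ (2 * S.card + 1) * 2 ^ m := Nat.mul_le_mul_right _ hHle'
        _ = 2 ^ (2 * S.card + 1 + m) := (pow_add 2 _ _).symm
        _ ≤ 2 ^ (2 * Tot.card + 2) := Nat.pow_le_pow_right (by norm_num) (by omega))
  set F₀ := X₀.filter (fun c => QuotientAddGroup.mk' H c = y) with hF₀
  have hF₀ne : F₀.Nonempty := by
    rw [← Finset.card_pos]
    exact lt_of_lt_of_le (Nat.two_pow_pos m) hy
  obtain ⟨x₀, hx₀⟩ := hF₀ne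
  refine ⟨F₀.image (fun c => c - x₀), ?_, ?_⟩
  · rw [Finset.card_image_of_injective _ (sub_left_injective)]
    exact hy
  · intro c hc
    rw [Finset.mem_image] at hc
    obtain ⟨x, hx, rfl⟩ := hc
    rw [hF₀, Finset.mem_filter] at hx hx₀
    obtain ⟨hxX, hxy⟩ := hx
    obtain ⟨hx₀X, hx₀y⟩ := hx₀
    rw [Finset.mem_image] at hxX hx₀X
    obtain ⟨dd, -, rfl⟩ := hxX
    obtain ⟨dd₀, -, rfl⟩ := hx₀X
    refine ⟨fun ℓ _ hℓT => ?_, fun v hv => ?_⟩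
    · -- parities vanish off `Tot`
      obtain ⟨a1, a2, -, -⟩ := hbits dd ℓ
      obtain ⟨b1, b2, -, -⟩ := hbits dd₀ ℓ
      have hℓ1 : ℓ ∉ dd.1.1.1 := fun hℓ' => hℓT (Finset.mem_powerset.mp dd.1.1.2 hℓ')
      have hℓ2 : ℓ ∉ dd.2.1.1 := fun hℓ' => hℓT (Finset.mem_powerset.mp dd.2.1.2 hℓ')
      have hℓ3 : ℓ ∉ dd₀.1.1.1 := fun hℓ' => hℓT (Finset.mem_powerset.mp dd₀.1.1.2 hℓ')
      have hℓ4 : ℓ ∉ dd₀.2.1.1 := fun hℓ' => hℓT (Finset.mem_powerset.mp dd₀.2.1.2 hℓ')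
      rw [if_neg hℓ1] at a1; rw [if_neg hℓ2] at a2; rw [if_neg hℓ3] at b1; rw [if_neg hℓ4] at b2
      rw [map_sub, map_sub, map_sub, map_sub, map_sub, map_sub, a1, b1, a2, b2, sub_zero]
      exact ⟨rfl, rfl⟩
    · -- `x - x₀ ∈ H ≤ H¹_𝓚(ℚ_v)`
      have hmem : Φ dd - Φ dd₀ ∈ H := by
        rw [← QuotientAddGroup.eq_iff_sub_mem, ← QuotientAddGroup.mk'_apply, ← QuotientAddGroup.mk'_apply, hxy, hx₀y]
      have hgen : natGenerator v = ((primesEquiv (R := 𝓞 ℚ)) v : ℕ) := rfl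
      have hvK : H ≤ K (natGenerator v) := by
        rw [hHdef]; exact Finset.inf_le hv
      have hKv : K (natGenerator v) = selmerLocalKer E (v.adicCompletion ℚ) 2 := by
        simp only [K, dif_pos (prime_natGenerator v)]
        have : (primesEquiv (R := 𝓞 ℚ)).symm ⟨natGenerator v, prime_natGenerator v⟩ = v := by
          rw [show (⟨natGenerator v, prime_natGenerator v⟩ : Nat.Primes) = primesEquiv (R := 𝓞 ℚ) v from rfl,
            Equiv.symm_apply_apply]
        rw [this]
      rw [← hKv]
      exact hvK hmem

end Count

end Summit.BirchSwinnertonDyer.BirchSwinnertonDyer.Theorems.GenusKolyvaginAtTwo.TorsionCellD0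

end
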